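import Mathlib
import Literature.Probability.RandomPlanarGeometry.LoopConfigurations
import HarnessLib

/-!
# Soft machine, brick 12: counting loops measurably from hitting events

Crux `Summit.CriticalPhenomena.CardyFormulaZ2.Theses.CardyMagicRigidity.NestingRigidity`
(stmt-CriticalPhenomena-4835), line `positive-cone-weight-doubling`, registered stub `stub_tamePrecompactness :
TamePrecompact zEns ∧ TamePrecompact tEns`.  `TamePrecompact` (p130599) asks, besides measurable closeness events,
for MEASURABLE TYPED COUNTS `s ↦ typedPatternCount (X s) i x r R S` of the limit presentation.  The soft machine's
presentations have measurable hitting events `{s | ∃ u ∈ (X s).F i, u ∈ Q}`, `Q` closed (`softMachine_limit`).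
This file shows that hitting events COUNT:

* `SoftMachine.exists_denseRange_unbasedLoop` — DKKMO's space of unbased loops `UnbasedLoop ℂ` (a metric space)
  has a dense sequence (it is a continuous image of the loops of the second-countable Aizenman–Burchard curve space,
  with a coarser distance);
* `SoftMachine.le_encard_iff_exists_hits` — in a metric space with a dense sequence `q`, a set has at least `n`
  elements iff, at some rational scale, it hits `n` closed balls of that radius centred at terms of `q` that are
  pairwise more than two radii apart;
* `softMachine_measurable_ncard_of_hit` (registered anchor) — hence for every `X` with measurable hitting events of
  closed sets and every OPEN set `A` of unbased loops, `s ↦ #((X s).F i ∩ A)` (`Set.ncard`, junk `0` when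
  infinite) is measurable.
-/

noncomputable section

open MeasureTheory Set Filter Metric TopologicalSpace Function
open scoped Topology ENNReal NNReal

namespace Summit.CriticalPhenomena.CardyFormulaZ2.Cruxes.NestingRigidity.PositiveConeWeightDoubling

open Literature.Probability.RandomPlanarGeometry

namespace SoftMachine

/-! ### A dense sequence of unbased loops -/

/-- DKKMO's space of unbased loops in the plane has a dense sequence. -/
theorem exists_denseRange_unbasedLoop : ∃ q : ℕ → UnbasedLoop ℂ, DenseRange q := by
  -- a dense sequence of loops for the Aizenman–Burchard distance
  set c₀ : CurveClass ℂ := CurveClass.mk ⟨ContinuousMap.const unitInterval (0 : ℂ)⟩ with hc₀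
  have hc₀loop : c₀.IsLoop := by rw [CurveClass.isLoop_iff]; rfl
  haveI : Nonempty {c : CurveClass ℂ // c.IsLoop} := ⟨⟨c₀, hc₀loop⟩⟩
  obtain ⟨d, hd⟩ := TopologicalSpace.exists_dense_seq {c : CurveClass ℂ // c.IsLoop}
  -- it is dense for the (coarser) unbased oriented distance of `BasedLoop`
  set q : ℕ → BasedLoop ℂ := fun n ↦ BasedLoop.mk (d n).1 (d n).2 with hq
  have hqd : DenseRange q := by
    rw [Metric.denseRange_iff]
    intro ℓ r hr
    obtain ⟨c, hc⟩ := ℓ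
    obtain ⟨n, hn⟩ := Metric.denseRange_iff.1 hd ⟨c, hc⟩ r hr
    refine ⟨n, lt_of_le_of_lt ?_ hn⟩
    exact BasedLoop.dist_le_dist_toCurveClass _ _
  exact ⟨UnbasedLoop.mk ∘ q, UnbasedLoop.mk_surjective.denseRange.comp hqd SeparationQuotient.continuous_mk⟩

/-! ### Counting with a dense sequence -/

/-- `n ≤ #s` (extended cardinality) iff `s` contains the range of an injective map from `Fin n`. -/
theorem le_encard_iff_exists_injective {α : Type*} (s : Set α) (n : ℕ) :
    (n : ℕ∞) ≤ s.encard ↔ ∃ f : Fin n → α, Function.Injective f ∧ ∀ j, f j ∈ s := by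
  classical
  constructor
  · intro h
    obtain ⟨t, hts, ht⟩ := Set.exists_subset_encard_eq h
    have htfin : t.Finite := Set.finite_of_encard_eq_coe ht
    have hcard : htfin.toFinset.card = n := by
      have := htfin.encard_eq_coe_toFinset_card
      rw [ht] at this
      exact_mod_cast this.symm
    set e := htfin.toFinset.equivFinOfCardEq hcard with he
    refine ⟨fun j ↦ (e.symm j).1, fun j l hjl ↦ e.symm.injective (Subtype.ext hjl), fun j ↦ hts ?_⟩
    exact htfin.mem_toFinset.1 (e.symm j).2
  · rintro ⟨f, hf, hfs⟩
    have hrange : (Set.range f).encard = n := by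
      rw [← Set.image_univ, (hf.injOn).encard_image, Set.encard_univ]
      simp
    rw [← hrange]
    exact Set.encard_le_encard (Set.range_subset_iff.2 hfs)

/-- **Counting through a dense sequence.**  In a metric space with a dense sequence `q`, a set `s` has at least
`n` elements iff for some `b : ℕ` and some `a : Fin n → ℕ` with `dist (q (a j)) (q (a l)) > 2/(b+1)` for `j ≠ l`,
`s` meets each closed ball `B̄(q (a j), 1/(b+1))`. -/
theorem le_encard_iff_exists_hits {α : Type*} [MetricSpace α] {q : ℕ → α} (hq : DenseRange q) (s : Set α)
    (n : ℕ) : (n : ℕ∞) ≤ s.encard ↔ ∃ (b : ℕ) (a : Fin n → ℕ),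
      (∀ j l, j ≠ l → 2 / ((b : ℝ) + 1) < dist (q (a j)) (q (a l))) ∧
      ∀ j, (s ∩ closedBall (q (a j)) (1 / ((b : ℝ) + 1))).Nonempty := by
  classical
  rw [le_encard_iff_exists_injective]
  constructor
  · rintro ⟨f, hf, hfs⟩
    -- a positive lower bound for the pairwise distances
    obtain ⟨ε₀, hε₀, hε⟩ : ∃ ε₀ : ℝ, 0 < ε₀ ∧ ∀ j l, j ≠ l → ε₀ ≤ dist (f j) (f l) := by
      by_cases hne : (Finset.univ.filter fun p : Fin n × Fin n ↦ p.1 ≠ p.2).Nonempty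
      · refine ⟨(Finset.univ.filter fun p : Fin n × Fin n ↦ p.1 ≠ p.2).inf' hne fun p ↦ dist (f p.1) (f p.2),
          ?_, fun j l hjl ↦ Finset.inf'_le (fun p : Fin n × Fin n ↦ dist (f p.1) (f p.2))
            (Finset.mem_filter.2 ⟨Finset.mem_univ (j, l), hjl⟩)⟩
        rw [Finset.lt_inf'_iff]
        intro p hp
        simp only [Finset.mem_filter, Finset.mem_univ, true_and] at hp
        exact dist_pos.2 fun h ↦ hp (hf h)
      · exact ⟨1, one_pos, fun j l hjl ↦ absurd ⟨(j, l), Finset.mem_filter.2 ⟨Finset.mem_univ _, hjl⟩⟩ hne⟩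
    obtain ⟨b, hb⟩ := exists_nat_gt (4 / ε₀)
    have hb' : 4 / ((b : ℝ) + 1) < ε₀ := by
      rw [div_lt_iff₀ (by positivity)]
      rw [div_lt_iff₀ hε₀] at hb
      nlinarith
    have hpos : (0 : ℝ) < 1 / ((b : ℝ) + 1) := by positivity
    choose a ha using fun j ↦ Metric.denseRange_iff.1 hq (f j) _ hpos
    refine ⟨b, a, fun j l hjl ↦ ?_, fun j ↦ ⟨f j, hfs j, mem_closedBall.2 (ha j).le⟩⟩
    have h1 := ha j
    have h2 := ha l
    have h3 := hε j l hjl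
    have htri : dist (f j) (f l) ≤ dist (f j) (q (a j)) + dist (q (a j)) (q (a l)) + dist (q (a l)) (f l) :=
      dist_triangle4 _ _ _ _
    rw [dist_comm (q (a l))] at htri
    have : 2 / ((b : ℝ) + 1) = 4 / ((b : ℝ) + 1) - 1 / ((b : ℝ) + 1) - 1 / ((b : ℝ) + 1) := by ring
    linarith
  · rintro ⟨b, a, hsep, hhit⟩
    choose u hu using hhit
    refine ⟨u, fun j l hjl ↦ ?_, fun j ↦ (hu j).1⟩
    by_contra hne
    have h := hsep j l hne
    have hj := mem_closedBall.1 (hu j).2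
    have hl := mem_closedBall.1 (hu l).2
    rw [hjl] at hj
    have : dist (q (a j)) (q (a l)) ≤ 1 / ((b : ℝ) + 1) + 1 / ((b : ℝ) + 1) := by
      calc dist (q (a j)) (q (a l)) ≤ dist (q (a j)) (u l) + dist (u l) (q (a l)) := dist_triangle _ _ _
        _ ≤ _ := add_le_add (by rw [dist_comm]; exact hj) hl
    have e2 : (2 : ℝ) / ((b : ℝ) + 1) = 1 / ((b : ℝ) + 1) + 1 / ((b : ℝ) + 1) := by ring
    linarith

/-! ### Measurability of the counts -/

variable {T : Type*} [MeasurableSpace T]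

/-- Measurable hitting events of closed sets give measurable hitting events of `A ∩ B̄` for `A` open and `B̄` a
closed ball (indeed any closed set). -/
theorem measurableSet_hit_open_inter_closed {X : T → LoopConfig ℂ}
    (hX : ∀ (i : Fin 2) (Q : Set (UnbasedLoop ℂ)), IsClosed Q → MeasurableSet {t | ∃ u ∈ (X t).F i, u ∈ Q})
    (i : Fin 2) {A C : Set (UnbasedLoop ℂ)} (hA : IsOpen A) (hC : IsClosed C) :
    MeasurableSet {t | ∃ u ∈ (X t).F i, u ∈ A ∩ C} := by
  obtain ⟨F, hFc, -, hFU, -⟩ := hA.exists_iUnion_isClosed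
  have hset : {t | ∃ u ∈ (X t).F i, u ∈ A ∩ C} = ⋃ n, {t | ∃ u ∈ (X t).F i, u ∈ F n ∩ C} := by
    ext t
    simp only [mem_setOf_eq, mem_iUnion, mem_inter_iff, ← hFU]
    exact ⟨fun ⟨u, hu, ⟨n, hn⟩, hc⟩ ↦ ⟨n, u, hu, hn, hc⟩, fun ⟨n, u, hu, hn, hc⟩ ↦ ⟨u, hu, ⟨n, hn⟩, hc⟩⟩
  rw [hset]
  exact MeasurableSet.iUnion fun n ↦ hX i _ ((hFc n).inter hC)

/-- The events "at least `n` loops of type `i` of `X t` lie in the open set `A`" are measurable. -/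
theorem measurableSet_le_encard_of_hit {X : T → LoopConfig ℂ}
    (hX : ∀ (i : Fin 2) (Q : Set (UnbasedLoop ℂ)), IsClosed Q → MeasurableSet {t | ∃ u ∈ (X t).F i, u ∈ Q})
    (i : Fin 2) {A : Set (UnbasedLoop ℂ)} (hA : IsOpen A) (n : ℕ) :
    MeasurableSet {t | (n : ℕ∞) ≤ ((X t).F i ∩ A).encard} := by
  classical
  obtain ⟨q, hq⟩ := exists_denseRange_unbasedLoop
  have hset : {t | (n : ℕ∞) ≤ ((X t).F i ∩ A).encard} = ⋃ b : ℕ, ⋃ a : Fin n → ℕ,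
      {_t : T | ∀ j l, j ≠ l → 2 / ((b : ℝ) + 1) < dist (q (a j)) (q (a l))} ∩
        ⋂ j : Fin n, {t | ∃ u ∈ (X t).F i, u ∈ A ∩ closedBall (q (a j)) (1 / ((b : ℝ) + 1))} := by
    ext t
    simp only [mem_setOf_eq, le_encard_iff_exists_hits hq, mem_iUnion, mem_inter_iff, mem_iInter]
    refine exists_congr fun b ↦ exists_congr fun a ↦ and_congr_right fun _ ↦ forall_congr' fun j ↦ ?_
    exact ⟨fun ⟨u, ⟨hu, huA⟩, huB⟩ ↦ ⟨u, hu, huA, huB⟩, fun ⟨u, hu, huA, huB⟩ ↦ ⟨u, ⟨hu, huA⟩, huB⟩⟩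
  rw [hset]
  refine MeasurableSet.iUnion fun b ↦ MeasurableSet.iUnion fun a ↦ MeasurableSet.inter ?_
    (MeasurableSet.iInter fun j ↦ measurableSet_hit_open_inter_closed hX i hA isClosed_closedBall)
  exact measurableSet_setOf.2 measurable_const

/-- Level sets of `Set.ncard` through `Set.encard`: positive values. -/
theorem ncard_eq_succ_iff {α : Type*} (s : Set α) (m : ℕ) :
    s.ncard = m + 1 ↔ ((m + 1 : ℕ) : ℕ∞) ≤ s.encard ∧ ¬ ((m + 2 : ℕ) : ℕ∞) ≤ s.encard := by
  rcases s.finite_or_infinite with hs | hs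
  · rw [hs.encard_eq_coe, ← Set.ncard_def]
    norm_cast
    omega
  · rw [hs.ncard, hs.encard_eq]
    simp

/-- Level sets of `Set.ncard` through `Set.encard`: the value `0` (empty or infinite). -/
theorem ncard_eq_zero_iff' {α : Type*} (s : Set α) :
    s.ncard = 0 ↔ ¬ ((1 : ℕ) : ℕ∞) ≤ s.encard ∨ ∀ n : ℕ, (n : ℕ∞) ≤ s.encard := by
  rcases s.finite_or_infinite with hs | hs
  · rw [hs.encard_eq_coe, ← Set.ncard_def]
    constructor
    · intro h; left; exact_mod_cast (by omega : ¬ 1 ≤ s.ncard)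
    · rintro (h | h)
      · have : ¬ 1 ≤ s.ncard := by exact_mod_cast h
        omega
      · have := h (s.ncard + 1)
        have : s.ncard + 1 ≤ s.ncard := by exact_mod_cast this
        omega
  · rw [hs.ncard, hs.encard_eq]
    simp

end SoftMachine

/-- **Registered anchor** (`softMachine_measurable_ncard_of_hit`): for a random typed loop configuration `X` on a
measurable space with measurable hitting events of closed sets of unbased loops, and an OPEN set `A` of unbased
loops, the number of loops of type `i` of `X t` in `A` (`Set.ncard`, `0` if infinite) is a measurable function of
`t`. -/
theorem softMachine_measurable_ncard_of_hit : ∀ (T : Type) [MeasurableSpace T] (X : T → LoopConfig ℂ),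
    (∀ (i : Fin 2) (Q : Set (UnbasedLoop ℂ)), IsClosed Q → MeasurableSet {t | ∃ u ∈ (X t).F i, u ∈ Q}) →
    ∀ (i : Fin 2) (A : Set (UnbasedLoop ℂ)), IsOpen A → Measurable fun t ↦ ((X t).F i ∩ A).ncard := by
  intro T _ X hX i A hA
  refine measurable_to_countable' fun m ↦ ?_
  rcases m with _ | m
  · have hset : (fun t ↦ ((X t).F i ∩ A).ncard) ⁻¹' {0} =
        {t | ((1 : ℕ) : ℕ∞) ≤ ((X t).F i ∩ A).encard}ᶜ ∪ ⋂ n : ℕ, {t | (n : ℕ∞) ≤ ((X t).F i ∩ A).encard} := by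
      ext t
      simp only [mem_preimage, mem_singleton_iff, SoftMachine.ncard_eq_zero_iff', mem_union, mem_compl_iff,
        mem_setOf_eq, mem_iInter]
    rw [hset]
    exact (SoftMachine.measurableSet_le_encard_of_hit hX i hA 1).compl.union
      (MeasurableSet.iInter fun n ↦ SoftMachine.measurableSet_le_encard_of_hit hX i hA n)
  · have hset : (fun t ↦ ((X t).F i ∩ A).ncard) ⁻¹' {m + 1} =
        {t | ((m + 1 : ℕ) : ℕ∞) ≤ ((X t).F i ∩ A).encard} ∩ {t | ((m + 2 : ℕ) : ℕ∞) ≤ ((X t).F i ∩ A).encard}ᶜ := by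
      ext t
      simp only [mem_preimage, mem_singleton_iff, SoftMachine.ncard_eq_succ_iff, mem_inter_iff, mem_compl_iff,
        mem_setOf_eq]
    rw [hset]
    exact (SoftMachine.measurableSet_le_encard_of_hit hX i hA _).inter
      (SoftMachine.measurableSet_le_encard_of_hit hX i hA _).compl

end Summit.CriticalPhenomena.CardyFormulaZ2.Cruxes.NestingRigidity.PositiveConeWeightDoubling

end
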